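import Summits.CriticalPhenomena.CardyFormulaZ2.Theorems.CardySusyWardParafermionPrecompactFourDartSplit
import Summits.CriticalPhenomena.CardyFormulaZ2.Theorems.CardySusyWardParafermionPrecompactTouchProfileTrivialBound
import Literature.Probability.LatticeModels.MedialInterfaceMeasurability

/-!
# The trivial bound on the sum-relation defect in a boundary layer (helper for `stub_sumRelationDefect`)

Line `kenyon-stream-second-relation` of the crux `ParafermionPrecompact` (route `CardySusyWard`, item
stmt-CriticalPhenomena-11293); vocabulary of `…KenyonDefs`. Registered sub-goal
`sumDefect_le_of_depth_le` (registered by lead 0, whose file bounced three times on gate restarts only;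
re-derived by lead c1, `prover-line-stmt-CriticalPhenomena-11293-c1-0`):

for a datum `E` with mesh `δ > 0`, an edge `p` of depth `edgeDepth E p ≤ M δ` (`M ≥ 1`) and any
exponent `pz ≥ 0`, `‖sRes (dartField E) p‖ ≤ 4 M^{pz} · defectProfile E pz p`.

Content: each of the four corners at the genuine medial vertex `mv p` has its dart starting or
ending AT `mv p` (`cornersAt_source_or_target`, from the landed corner geometry `corners_at_mv`), so
its phase sum vanishes unless the exploration visits `mv p` (`dartPhaseSum_eq_zero_of_target_not_mem`
and the tree's source version) and its expectation is bounded by the touch probability of ANY ball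
around the midpoint (`norm_dartField_cornersAt_le`); hence `‖sRes‖ ≤ 4 · touchProb (mid, depth/2)`,
and `(δ/depth)^{pz} ≥ M^{-pz}` in the layer turns this into `4 M^{pz} · defectProfile`. So the
defect law of STUB 4 is free in every boundary layer of bounded lattice depth; its content is the
DECAY in the depth. References: H. Duminil-Copin, S. Smirnov, Clay Math. Proc. 15 (2012), §8.3
[DuminilCopinSmirnov2012Lattice].
-/

noncomputable section

namespace Summit.CriticalPhenomena.CardyFormulaZ2.Cruxes.ParafermionPrecompact.KenyonStreamSecondRelation

open scoped BigOperators Topology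
open Filter Set MeasureTheory
open _root_.Literature.Probability.LatticeModels
open _root_.Literature.Probability.Percolation (BondConfig bondPercolation half)

/-! ### Vanishing of the dart phase off the path -/

/-- A dart whose TARGET edge is not on the path contributes no phase (twin of the tree's
`dartPhaseSum_eq_zero_of_not_mem` for the source). [folklore] -/
theorem dartPhaseSum_eq_zero_of_target_not_mem {γ : List MedialVertex} (δ σ : ℝ)
    {c : Site 2 × Site 2} (h : cornerTarget c.1 c.2 ∉ γ) : Parafermion.dartPhaseSum γ δ σ c = 0 := by
  refine Finset.sum_eq_zero fun k hk => ?_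
  exact absurd (List.mem_of_getElem? (Finset.mem_filter.1 hk).2.2) h

/-- **Each of the four corners at `mv (x, i)` starts or ends there**: the clockwise corners
`NW, NE, SE, SW` at the genuine medial vertex `s(x, x + eᵢ)` are, in class coordinates, the two
outgoing darts (source `= mv (x, i)`) and the two incoming darts (target `= mv (x, i)`) of
`corners_at_mv`. [folklore] -/
theorem cornersAt_source_or_target (x : Site 2) (i : Fin 2) (k : Fin 4) :
    cornerSource (cornersAt x i k).1 (cornersAt x i k).2 = mv (x, i) ∨
      cornerTarget (cornersAt x i k).1 (cornersAt x i k).2 = mv (x, i) := by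
  obtain ⟨⟨h1, h2⟩, ⟨h3, h4⟩, -, -⟩ := corners_at_mv x i
  fin_cases i <;> fin_cases k
  · exact Or.inl (by simpa [cornersAt, classOffset] using h1)
  · exact Or.inr (by simpa [cornersAt, classOffset] using h4)
  · exact Or.inl (by simpa [cornersAt, classOffset, sub_eq_add_neg, add_assoc] using h2)
  · exact Or.inr (by simpa [cornersAt, classOffset, sub_eq_add_neg] using h3)
  · exact Or.inr (by simpa [cornersAt, classOffset, sub_eq_add_neg, add_assoc, add_comm, add_left_comm] using h4)
  · exact Or.inl (by simpa [cornersAt, classOffset, sub_eq_add_neg] using h2)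
  · exact Or.inr (by simpa [cornersAt, classOffset] using h3)
  · exact Or.inl (by simpa [cornersAt, classOffset, sub_eq_add_neg] using h1)

/-- **The dart field at a corner of `mv (x, i)` is bounded by the touch probability of any ball
around the midpoint**: the phase sum has norm `≤ 1` and vanishes unless the exploration visits
`mv (x, i)` itself. [folklore] -/
theorem norm_dartField_cornersAt_le (E : DiscreteDobrushin) (x : Site 2) (i : Fin 2) (k : Fin 4)
    {r : ℝ} (hr : 0 ≤ r) :
    ‖dartField E (cornersAt x i k)‖ ≤ touchProb E (medialPoint E.δ (mv (x, i))) r := by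
  simp only [dartField, Parafermion.bondDartObservable_def, touchProb]
  set S : Set (BondConfig (Site 2)) :=
    {ω | ∃ e ∈ medialExploration E ω, dist (medialPoint E.δ e) (medialPoint E.δ (mv (x, i))) ≤ r}
  set f : BondConfig (Site 2) → ℂ := fun ω =>
    Parafermion.dartPhaseSum (medialExploration E ω) E.δ (1 / 3) (cornersAt x i k)
  have hSm : MeasurableSet S :=
    measurableSet_setOf.2 (measurable_of_medialExploration E
      (F := fun ω => ∃ e ∈ medialExploration E ω,
        dist (medialPoint E.δ e) (medialPoint E.δ (mv (x, i))) ≤ r)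
      fun _ _ h => by simp only [h])
  have hfS : f = S.indicator f := by
    funext ω
    by_cases hω : ω ∈ S
    · rw [indicator_of_mem hω]
    · rw [indicator_of_notMem hω]
      have hmv : mv (x, i) ∉ medialExploration E ω := fun hmem =>
        hω ⟨_, hmem, by rw [dist_self]; exact hr⟩
      rcases cornersAt_source_or_target x i k with h | h
      · exact Parafermion.dartPhaseSum_eq_zero_of_not_mem _ _ (by rw [h]; exact hmv)
      · exact dartPhaseSum_eq_zero_of_target_not_mem _ _ (by rw [h]; exact hmv)
  change ‖∫ ω, f ω ∂_‖ ≤ _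
  rw [hfS, integral_indicator hSm]
  refine (norm_setIntegral_le_of_norm_le_const (measure_lt_top _ _) fun ω _ => ?_).trans
    (by rw [one_mul])
  exact Parafermion.norm_dartPhaseSum_le_one (Parafermion.nodup_zip_tail_medialExploration E ω) _ _ _

/-- `‖sRes Φ p‖` is at most the sum of the norms of the four corner values. [folklore] -/
theorem norm_sRes_le (Φ : Site 2 × Site 2 → ℂ) (p : Site 2 × Fin 2) :
    ‖sRes Φ p‖ ≤ ‖Φ (cornersAt p.1 p.2 0)‖ + ‖Φ (cornersAt p.1 p.2 1)‖ +
      ‖Φ (cornersAt p.1 p.2 2)‖ + ‖Φ (cornersAt p.1 p.2 3)‖ := by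
  unfold sRes
  calc ‖Φ (cornersAt p.1 p.2 0) - Φ (cornersAt p.1 p.2 1) + Φ (cornersAt p.1 p.2 2) -
          Φ (cornersAt p.1 p.2 3)‖
      ≤ ‖Φ (cornersAt p.1 p.2 0) - Φ (cornersAt p.1 p.2 1) + Φ (cornersAt p.1 p.2 2)‖ +
          ‖Φ (cornersAt p.1 p.2 3)‖ := norm_sub_le _ _
    _ ≤ ‖Φ (cornersAt p.1 p.2 0) - Φ (cornersAt p.1 p.2 1)‖ + ‖Φ (cornersAt p.1 p.2 2)‖ +
          ‖Φ (cornersAt p.1 p.2 3)‖ := by gcongr; exact norm_add_le _ _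
    _ ≤ ‖Φ (cornersAt p.1 p.2 0)‖ + ‖Φ (cornersAt p.1 p.2 1)‖ + ‖Φ (cornersAt p.1 p.2 2)‖ +
          ‖Φ (cornersAt p.1 p.2 3)‖ := by gcongr; exact norm_sub_le _ _

/-- **The sum-relation defect is bounded by four touch probabilities**:
`‖sRes (dartField E) p‖ ≤ 4 · touchProb E (midpoint of p) r` for every radius `r ≥ 0`. [folklore] -/
theorem norm_sRes_dartField_le (E : DiscreteDobrushin) (p : Site 2 × Fin 2) {r : ℝ} (hr : 0 ≤ r) :
    ‖sRes (dartField E) p‖ ≤ 4 * touchProb E (medialPoint E.δ (mv p)) r := by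
  obtain ⟨x, i⟩ := p
  have h := fun k => norm_dartField_cornersAt_le E x i k hr
  have h0 := h 0
  have h1 := h 1
  have h2 := h 2
  have h3 := h 3
  linarith [norm_sRes_le (dartField E) (x, i)]

/-! ### The registered sub-goal -/

/-- **Registered sub-goal `sumDefect_le_of_depth_le`** (helper for `stub_sumRelationDefect` of the line
`kenyon-stream-second-relation`): in a boundary layer of lattice depth `≤ M` (`edgeDepth E p ≤ M δ`,
`M ≥ 1`) the sum-relation defect of the spin-`1/3` dart field obeys the defect law with constant
`4 M^{pz}`, for every exponent `pz ≥ 0`: `‖sRes (dartField E) p‖ ≤ 4 M^{pz} · defectProfile E pz p`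
(`defectProfile = (δ/depth)^{pz} × touchProb (mid, depth/2)` and `(δ/depth)^{pz} ≥ M^{-pz}`). [folklore] -/
theorem sumDefect_le_of_depth_le :
    ∀ (E : DiscreteDobrushin), 0 < E.δ → ∀ (M pz : ℝ), 1 ≤ M → 0 ≤ pz → ∀ p : Site 2 × Fin 2, edgeDepth E p ≤ M * E.δ → ‖sRes (dartField E) p‖ ≤ 4 * M ^ pz * defectProfile E pz p := by
  intro E hE M pz hM hpz p hdepth
  have hM0 : 0 < M := by linarith
  have hd := edgeDepth_pos hE p
  set t := touchProb E (medialPoint E.δ (mv p)) (edgeDepth E p / 2) with ht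
  have ht0 : 0 ≤ t := touchProb_nonneg _ _ _
  have hs : ‖sRes (dartField E) p‖ ≤ 4 * t := norm_sRes_dartField_le E p (by positivity)
  have hratio : M⁻¹ ≤ E.δ / edgeDepth E p := by
    rw [inv_eq_one_div, div_le_div_iff₀ hM0 hd]
    linarith
  have hpow : M⁻¹ ^ pz ≤ (E.δ / edgeDepth E p) ^ pz :=
    Real.rpow_le_rpow (inv_nonneg.2 hM0.le) hratio hpz
  have hMpz : M ^ pz * M⁻¹ ^ pz = 1 := by
    rw [Real.inv_rpow hM0.le, mul_inv_cancel₀ (Real.rpow_pos_of_pos hM0 _).ne']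
  have hMpz0 : 0 ≤ M ^ pz := Real.rpow_nonneg hM0.le _
  calc ‖sRes (dartField E) p‖ ≤ 4 * t := hs
    _ = 4 * (M ^ pz * M⁻¹ ^ pz) * t := by rw [hMpz, mul_one]
    _ ≤ 4 * (M ^ pz * (E.δ / edgeDepth E p) ^ pz) * t := by gcongr
    _ = 4 * M ^ pz * defectProfile E pz p := by rw [ht]; unfold defectProfile; ring

end Summit.CriticalPhenomena.CardyFormulaZ2.Cruxes.ParafermionPrecompact.KenyonStreamSecondRelation

end
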